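import Literature.NumberTheory.GaloisCohomology.Howard2004.DVRSettingEngineSmallProofs
import HarnessLib

/-!
# Howard 2004, Prop. 1.5.5 in the ENGINE's currency: «`ε` is independent of `n`» — the algebraic half
# (`ε ≡ dim_{R/𝔪} 𝓗(n)[𝔪] (mod 2)` for ANY decomposition), with the parity of `dim 𝓗(n)[𝔪]` as the one input

Topic `NumberTheory/GaloisCohomology/Howard2004`. THEOREMS ONLY: no definition, no named fact, no instance, no
notation, no `sorry`. Cell `pub/bsd-print-x9`, print leaf G87 = `thm161_dvrKolyvaginBound` (Howard Thm. 1.6.1),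
registered pseudo-stub `stub_h161` of the μ-crux `MuInequalityCoherentPair` (stmt-BirchSwinnertonDyer-22642); seat
`bsd-line-x9-p1` LEAD g9, brick (EPS-CONST) named by x9-p1-w4 g17 for its ENGINE-h159 assembly (Prop. 1.5.9 needs
the SAME `ε` at `n` and at `nℓ`).

SOURCE. B. Howard, *The Heegner point Kolyvagin system*, Compositio Math. **140** (2004) = arXiv:1202.6340, §1.5
(p0010 L50–75): «for each `n ∈ 𝓝` there is an `R`-module `M(n)` and an integer `ε` such that
`𝓗(n) ≅ R^ε ⊕ M(n) ⊕ M(n)`. […] we can (and do) take `ε ∈ {0,1}`. It will be seen momentarily that `ε` is independent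
of `n`. […] **Proposition 1.5.5.** The integer `ε` appearing in the decomposition is congruent to `ρ(n) (mod 2)` and is
therefore independent of `n ∈ 𝓝` by Lemma 1.5.3. *Proof.* We have `ε + 2 dim_{R/𝔪} M(n)[𝔪] = dim_{R/𝔪} 𝓗(n)[𝔪] = ρ(n)`,
the second equality by Lemma 1.3.3.»

WHAT IS PROVED (the ALGEBRAIC HALF of Prop. 1.5.5, for arbitrary — not only the chosen — decompositions):
* §1 `epsilon_mod_two_eq_of_linearEquiv` — generic over a DVR: `H ≃ₗ[R] (Fin ε → R/𝔪^e) × (M × M)`, `e ≥ 1`,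
  `M` finite ⟹ `ε % 2 = dim_{R/(π)} H[π] % 2`; `epsilon_eq_of_linearEquiv_of_finrank_mod_two_eq` — two such modules
  whose `π`-torsions have dimensions OF THE SAME PARITY and `ε, ε' ≤ 1` have `ε = ε'` (x10b-p1-w7's
  `eq_of_linearEquiv_pi_prod_prod_self_of_torsionBy_linearEquiv` asks for an isomorphism of the `π`-torsions; across
  `n ↦ nℓ` the torsions `𝓗̄(n)`, `𝓗̄(nℓ)` are NOT isomorphic — only `ρ(nℓ) ≡ ρ(n) (mod 2)`, Lemma 1.5.3).
* §2 **`DVRSetting.epsilon_eq_of_linearEquiv_decompositions`** — the ENGINE form asked for by ENGINE-h159, in its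
  consumer's binder shape: on a `DVRSetting` with H.0–H.5, for `n ⊆ 𝓛^{(2k-1)}`, `q ∈ 𝓛^{(2k-1)} ∖ n` and ANY two
  `R`-linear decompositions `𝓗(n) ≃ (R/𝔪^{e_k})^{ε₁} × (M₁ × M₁)`, `𝓗(nq) ≃ (R/𝔪^{e_k})^{ε₂} × (M₂ × M₂)` (`𝓗(·) =
  selmerModuleAt`, `εᵢ ≤ 1`, `Mᵢ` finite): `ε₁ = ε₂`, GIVEN the one Galois input in `hsmall`'s currency —
  `dim_{R/(π)} 𝓗(n)[π] ≡ dim_{R/(π)} 𝓗(nq)[π] (mod 2)` (= «`ρ(nq) ≡ ρ(n) (mod 2)`», Lemma 1.5.3 with Lemma 1.3.3; supplied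
  by the parity line of the cell, binder `hpar` here); and `DVRSetting.epsilon_mod_two_eq` (one decomposition:
  `ε % 2 = dim 𝓗(n)[π] % 2`).

HONEST FRAMING: the Galois half of Prop. 1.5.5 (Lemma 1.5.3's `ρ(nℓ)^± = ρ(n)^± ∓ 1` at every `ℓ ∈ 𝓛`, and Lemma
1.3.3's `𝓗(n)[𝔪] ≅ 𝓗̄(n)`) is NOT proved here — it is the hypothesis `hpar`; `thm161_dvrKolyvaginBound` is NOT proved;
no summit statement is proved; the Birch–Swinnerton-Dyer conjecture is not proved by any of this.
-/

set_option autoImplicit false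

noncomputable section

open Function NumberField IsDedekindDomain Field Module Submodule
open scoped NumberField ContRepresentation Classical

/-! ## §1 Generic: `ε ≡ dim H[π] (mod 2)` and `ε` from the parity of `dim H[π]` -/

namespace Literature.Algebra.Module

variable {R : Type*} [CommRing R] [IsDomain R] [IsDiscreteValuationRing R] {ϖ : R}

/-- **`ε ≡ dim_{R/(ϖ)} H[ϖ] (mod 2)`** for ANY decomposition `H ≅ (R/𝔪^e)^ε × (M × M)` over a DVR (`e ≥ 1`, `M`
finite): Howard's count `ε + 2 dim M[𝔪] = dim 𝓗[𝔪]` read modulo `2`.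
[cite: Howard2004HeegnerKolyvagin, Prop. 1.5.5 (proof) = arXiv:1202.6340 Prop. 2.5.5, p0010 L72–L75] -/
theorem epsilon_mod_two_eq_of_linearEquiv (hϖ : Irreducible ϖ) {H : Type*} [AddCommGroup H] [Module R H]
    {e : ℕ} (he : 1 ≤ e) {ε : ℕ} {M : Type*} [AddCommGroup M] [Module R M] [Module.Finite R M]
    (θ : H ≃ₗ[R] (Fin ε → R ⧸ IsLocalRing.maximalIdeal R ^ e) × (M × M)) :
    ε % 2 = Module.finrank (R ⧸ R ∙ ϖ) ↥(torsionBy R H ϖ) % 2 := by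
  rw [finrank_torsionBy_eq_of_linearEquiv_pi_prod_prod_self hϖ
    (finrank_torsionBy_quotient_maximalIdeal_pow hϖ he) θ]
  omega

/-- **`ε` is determined by the PARITY of `dim H[ϖ]`**: two modules decomposed as `H ≅ (R/𝔪^e)^ε × (M × M)`,
`H' ≅ (R/𝔪^{e'})^{ε'} × (M' × M')` (`e, e' ≥ 1`, `ε, ε' ≤ 1`, `M, M'` finite) with
`dim H[ϖ] ≡ dim H'[ϖ] (mod 2)` have `ε = ε'` («`ε` … is congruent to `ρ(n) (mod 2)` and is therefore independent of
`n`»). [cite: Howard2004HeegnerKolyvagin, Prop. 1.5.5 = arXiv:1202.6340 Prop. 2.5.5, p0010 L67–L75] -/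
theorem epsilon_eq_of_linearEquiv_of_finrank_mod_two_eq (hϖ : Irreducible ϖ)
    {H : Type*} [AddCommGroup H] [Module R H] {H' : Type*} [AddCommGroup H'] [Module R H']
    {e e' : ℕ} (he : 1 ≤ e) (he' : 1 ≤ e') {ε ε' : ℕ} (hε : ε ≤ 1) (hε' : ε' ≤ 1)
    {M : Type*} [AddCommGroup M] [Module R M] [Module.Finite R M]
    {M' : Type*} [AddCommGroup M'] [Module R M'] [Module.Finite R M']
    (θ : H ≃ₗ[R] (Fin ε → R ⧸ IsLocalRing.maximalIdeal R ^ e) × (M × M))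
    (θ' : H' ≃ₗ[R] (Fin ε' → R ⧸ IsLocalRing.maximalIdeal R ^ e') × (M' × M'))
    (hpar : Module.finrank (R ⧸ R ∙ ϖ) ↥(torsionBy R H ϖ) % 2 =
      Module.finrank (R ⧸ R ∙ ϖ) ↥(torsionBy R H' ϖ) % 2) : ε = ε' := by
  have h₁ := epsilon_mod_two_eq_of_linearEquiv hϖ he θ
  have h₂ := epsilon_mod_two_eq_of_linearEquiv hϖ he' θ'
  omega

end Literature.Algebra.Module

/-! ## §2 On a `DVRSetting`: the ENGINE form -/

namespace Literature.NumberTheory.GaloisCohomology.Howard2004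

open Literature.NumberTheory.GaloisRepresentations
open Literature.NumberTheory.GaloisRepresentations.DiscreteGaloisModule
open Literature.Algebra.Module

namespace DVRSetting

variable {p : ℕ} [Fact p.Prime] {K : Type} [Field K] [NumberField K]
  {R : Type} [CommRing R] [IsDomain R] [IsDiscreteValuationRing R] [Algebra ℤ_[p] R]
  {N : ℕ → Type} [∀ k, AddCommGroup (N k)] [∀ k, TopologicalSpace (N k)]
  [∀ k, DiscreteTopology (N k)] [∀ k, Module R (N k)]
  {Rk : ℕ → Type} [∀ k, CommRing (Rk k)] [∀ k, IsLocalRing (Rk k)] [∀ k, TopologicalSpace (Rk k)]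
  [∀ k, DiscreteTopology (Rk k)] [∀ k, Algebra ℤ_[p] (Rk k)] [∀ k, Algebra R (Rk k)]
  [∀ k, Module (Rk k) (N k)] [∀ k, IsScalarTower R (Rk k) (N k)]
  {Nbar : Type} [AddCommGroup Nbar] [TopologicalSpace Nbar] [DiscreteTopology Nbar]
  [∀ k, Module (Rk k) Nbar]
  {Nq : ℕ → Finset (HeightOneSpectrum (𝓞 K)) → Type} [∀ k n, AddCommGroup (Nq k n)]
  [∀ k n, TopologicalSpace (Nq k n)] [∀ k n, DiscreteTopology (Nq k n)]
  [∀ k n, Module (Rk k) (Nq k n)] [∀ k n, Module R (Nq k n)]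
  [∀ k n, IsScalarTower R (Rk k) (Nq k n)]

/-- **`ε ≡ dim_{R/𝔪} 𝓗(n)[𝔪] (mod 2)` on a `DVRSetting`** for ANY `R`-linear decomposition
`𝓗(n) = selmerModuleAt ≃ (R/𝔪^{e_k})^ε × (M × M)`, `M` finite (not only the chosen one of `HasLevelDecompositions`).
[cite: Howard2004HeegnerKolyvagin, Prop. 1.5.5 (proof) = arXiv:1202.6340 Prop. 2.5.5, p0010 L72–L75] -/
theorem epsilon_mod_two_eq (S : DVRSetting p K R N Rk Nbar Nq) (hy : S.SatisfiesH) (k : ℕ)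
    (n : Finset (HeightOneSpectrum (𝓞 K))) {ε : ℕ} {M : Type} [AddCommGroup M] [Module R M] [Finite M]
    (θ : letI := galoisCohomology.moduleH1 (S.T.ρ k) (S.T.hlin k)
      ↥(S.selmerModuleAt hy k n) ≃ₗ[R] ((Fin ε → R ⧸ IsLocalRing.maximalIdeal R ^ S.e k) × (M × M))) :
    letI := galoisCohomology.moduleH1 (S.T.ρ k) (S.T.hlin k)
    ε % 2 = Module.finrank (R ⧸ R ∙ S.π) ↥(Submodule.torsionBy R ↥(S.selmerModuleAt hy k n) S.π) % 2 := by
  letI := galoisCohomology.moduleH1 (S.T.ρ k) (S.T.hlin k)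
  have hϖ : Irreducible S.π := (IsDiscreteValuationRing.irreducible_iff_uniformizer S.π).mpr hy.unif
  have h1e : 1 ≤ S.e k := le_trans (Nat.one_le_of_lt hy.e_zero) (hy.e_strictMono.monotone (Nat.zero_le k))
  haveI : Module.Finite R M := Module.Finite.of_finite
  exact epsilon_mod_two_eq_of_linearEquiv hϖ h1e θ

/-- **HOWARD 2004, PROP. 1.5.5 — «`ε` is independent of `n`», ENGINE FORM (the binder `hε` of ENGINE-h159).** On a
`DVRSetting` with H.0–H.5, for `n ⊆ 𝓛^{(2k-1)}` and `q ∈ 𝓛^{(2k-1)} ∖ n`: ANY two `R`-linear decompositions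
`𝓗(n) ≃ (R/𝔪^{e_k})^{ε₁} × (M₁ × M₁)` and `𝓗(nq) ≃ (R/𝔪^{e_k})^{ε₂} × (M₂ × M₂)` with `ε₁, ε₂ ≤ 1`, `M₁, M₂` finite
have `ε₁ = ε₂`, GIVEN «`ρ(nq) ≡ ρ(n) (mod 2)`» in `hsmall`'s currency — the parity of `dim_{R/(π)} 𝓗(·)[π]` is the
same at `n` and at `nq` (Lemma 1.5.3 (a)/(b): `ρ(nq)^± = ρ(n)^± ∓ 1`, read through Lemma 1.3.3
`𝓗(n)[𝔪] ≅ 𝓗̄(n)`; binder `hpar`, supplied by the cell's parity line). The guards `hn`, `hq`, `hqn` are the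
consumer's (they are not used by the algebra).
[cite: Howard2004HeegnerKolyvagin, Prop. 1.5.5 and Lemma 1.5.3 = arXiv:1202.6340 Prop. 2.5.5 / Lemma 2.5.3, p0009 L139 – p0010 L75] -/
theorem epsilon_eq_of_linearEquiv_decompositions (S : DVRSetting p K R N Rk Nbar Nq) (hy : S.SatisfiesH)
    (k : ℕ) (n : Finset (HeightOneSpectrum (𝓞 K))) (q : HeightOneSpectrum (𝓞 K))
    (_hn : ↑n ⊆ S.enginePrimes k) (_hq : q ∈ S.enginePrimes k) (_hqn : q ∉ n)
    {ε₁ ε₂ : ℕ} {M₁ M₂ : Type} [AddCommGroup M₁] [Module R M₁] [AddCommGroup M₂] [Module R M₂]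
    [Finite M₁] [Finite M₂] (hε₁ : ε₁ ≤ 1) (hε₂ : ε₂ ≤ 1)
    (h₁ : letI := galoisCohomology.moduleH1 (S.T.ρ k) (S.T.hlin k)
      Nonempty (↥(S.selmerModuleAt hy k n) ≃ₗ[R]
        ((Fin ε₁ → R ⧸ IsLocalRing.maximalIdeal R ^ S.e k) × (M₁ × M₁))))
    (h₂ : letI := galoisCohomology.moduleH1 (S.T.ρ k) (S.T.hlin k)
      Nonempty (↥(S.selmerModuleAt hy k (insert q n)) ≃ₗ[R]
        ((Fin ε₂ → R ⧸ IsLocalRing.maximalIdeal R ^ S.e k) × (M₂ × M₂))))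
    (hpar : letI := galoisCohomology.moduleH1 (S.T.ρ k) (S.T.hlin k)
      Module.finrank (R ⧸ R ∙ S.π) ↥(Submodule.torsionBy R ↥(S.selmerModuleAt hy k n) S.π) % 2 =
        Module.finrank (R ⧸ R ∙ S.π) ↥(Submodule.torsionBy R ↥(S.selmerModuleAt hy k (insert q n)) S.π) % 2) :
    ε₁ = ε₂ := by
  letI := galoisCohomology.moduleH1 (S.T.ρ k) (S.T.hlin k)
  obtain ⟨θ₁⟩ := h₁
  obtain ⟨θ₂⟩ := h₂
  have e₁ := S.epsilon_mod_two_eq hy k n θ₁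
  have e₂ := S.epsilon_mod_two_eq hy k (insert q n) θ₂
  omega

end DVRSetting

end Literature.NumberTheory.GaloisCohomology.Howard2004
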